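import Literature.NumberTheory.Sieve.MaynardOperatorRayleigh
import Literature.Analysis.SpecialFunctions.KernelLogRatio
import Mathlib.Analysis.SpecialFunctions.Log.Deriv
import Mathlib.MeasureTheory.Integral.IntervalIntegral.FundThmCalculus
import Mathlib.MeasureTheory.Measure.Lebesgue.Basic
import HarnessLib

/-!
# Polymath 8b, Corollary 6.3: the exact value of `M₂`

Topic `Literature/NumberTheory/Sieve`; companion of `MaynardOperatorRayleigh.lean` (Polymath 8b,
Corollary 6.2: a positive eigenfunction of `ℒ` computes `M_k`), which prints: "This allows for an
exact calculation of `M_2`".  We formalise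

**Polymath 8b, Corollary 6.3 (Computation of `M₂`).**  `M_2 = 1/(1 - W(1/e)) = 1.38593…`, where
the Lambert function `W(x)` is the positive solution of `x = W e^W`
[cite: Polymath8b2014, Corollary 6.3 (p. 24)].

The printed proof: with `λ := 1/(1 - W(1/e))` "a brief calculation shows that
`2λ - 1 = λ log λ - λ log(λ-1)`" (display (ll1)); the function
`f(x) := 1/(λ-1+x) + (1/(2λ-1)) log((λ-x)/(λ-1+x))` on `[0,1]` satisfies
`∫_0^{1-x} f(y) dy = ((λ-1+x)/(2λ-1)) log((λ-x)/(λ-1+x)) + (λ log λ - λ log(λ-1))/(2λ-1)`, hence by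
(ll1) `∫_0^{1-x} f(y) dy = (λ-1+x) f(x)`; then `F(x,y) := f(x) + f(y)` on `R_2` satisfies
`∫_0^{1-y} F(x',y) dx' + ∫_0^{1-x} F(x,y') dy' = λ F(x,y)`, and Corollary 6.2 gives `M_2 = λ`.

## What is proved (Mathlib + the tree's `maynardFunctional_eq_of_eigenfunction`; no new facts)

* `PolymathMTwo.f`, `PolymathMTwo.antideriv`, `PolymathMTwo.hasDerivAt_antideriv`,
  `PolymathMTwo.integral_f` — the displayed antiderivative identity (for every `λ > 1`);
* `PolymathMTwo.integral_f_eq_mul` — `∫_0^{1-x} f = (λ-1+x) f(x)` under (ll1);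
* `PolymathMTwo.f_one`, `PolymathMTwo.f_strictAntiOn`, `PolymathMTwo.f_pos` — under (ll1), `f` is
  strictly decreasing on `[0,1]` with `f(1) = 0` (so `F > 0` on `R_2`, which Corollary 6.2 needs);
* `PolymathMTwo.testFn` (`= 1_{R_2}·(f(t₀)+f(t₁))`) and `PolymathMTwo.maynardOperator_testFn` — the
  eigen-equation `ℒF = λF` on `R_2` (with the correct fibre limits `1 - t₁`, `1 - t₀`);
* `PolymathMTwo.exists_root`, `PolymathMTwo.mTwo`, `PolymathMTwo.mTwo_mem_Ioo` — (ll1) has a root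
  `λ ∈ (1.38593, 1.38594)` (intermediate value theorem; the endpoint signs are kernel-certified
  through the tree's `KernelLogRatio.log_ratio_mem` enclosures of `log(λ/(λ-1))`), and
  `PolymathMTwo.mTwo_lambertW` — `w := 1 - 1/λ` satisfies `w e^w = e^{-1}`, i.e. `λ = 1/(1-W(1/e))`;
* `Literature.NumberTheory.Sieve.maynardFunctional_two_eq` — **Corollary 6.3**: every admissible `F`
  on `R_2` has `(J^{(1)}(F)+J^{(2)}(F))/I(F) ≤ λ`, and the test function attains `λ`; i.e. `M_2 = λ`
  (`isGreatest_maynardFunctional_two`).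

## References

* D. H. J. Polymath, *Variants of the Selberg sieve, and bounded intervals containing many
  primes*, Res. Math. Sci. 1 (2014), Art. 12 = arXiv:1407.4897, Corollary 6.3, p. 24 of the arXiv
  text. [Polymath8b2014]
-/

namespace Literature.NumberTheory.Sieve

open MeasureTheory Set Filter Finset
open scoped ENNReal BigOperators

namespace PolymathMTwo

/-! ### The one-variable profile `f` and its antiderivative (any `λ > 1`) -/

/-- Polymath's profile `f(x) = 1/(λ-1+x) + (1/(2λ-1)) log((λ-x)/(λ-1+x))` (proof of Corollary 6.3).
[cite: Polymath8b2014, Corollary 6.3 (proof, definition of f)] -/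
noncomputable def f (l x : ℝ) : ℝ :=
  1 / (l - 1 + x) + 1 / (2 * l - 1) * Real.log ((l - x) / (l - 1 + x))

/-- An antiderivative of `f`: `A(u) = log(λ-1+u) - ((λ-u) log(λ-u) + (λ-1+u) log(λ-1+u))/(2λ-1)`.
[cite: Polymath8b2014, Corollary 6.3 (proof, "a further brief calculation")] -/
noncomputable def antideriv (l u : ℝ) : ℝ :=
  Real.log (l - 1 + u) - ((l - u) * Real.log (l - u) + (l - 1 + u) * Real.log (l - 1 + u)) / (2 * l - 1)

/-- `A' = f` wherever `λ - 1 + u > 0` and `λ - u > 0`.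
[cite: Polymath8b2014, Corollary 6.3 (proof, "a further brief calculation")] -/
theorem hasDerivAt_antideriv {l u : ℝ} (h1 : 0 < l - 1 + u) (h2 : 0 < l - u) :
    HasDerivAt (antideriv l) (f l u) u := by
  have d1 : HasDerivAt (fun y : ℝ => l - 1 + y) 1 u := by
    simpa using (hasDerivAt_id' u).const_add (l - 1)
  have d2 : HasDerivAt (fun y : ℝ => l - y) (-1) u := by
    simpa using (hasDerivAt_id' u).const_sub l
  have dlog1 : HasDerivAt (fun y : ℝ => Real.log (l - 1 + y)) (1 / (l - 1 + u)) u := d1.log h1.ne'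
  have dlog2 : HasDerivAt (fun y : ℝ => Real.log (l - y)) ((-1) / (l - u)) u := d2.log h2.ne'
  have dP1 : HasDerivAt (fun y : ℝ => (l - y) * Real.log (l - y))
      ((-1) * Real.log (l - u) + (l - u) * ((-1) / (l - u))) u := d2.mul dlog2
  have dP2 : HasDerivAt (fun y : ℝ => (l - 1 + y) * Real.log (l - 1 + y))
      (1 * Real.log (l - 1 + u) + (l - 1 + u) * (1 / (l - 1 + u))) u := d1.mul dlog1
  have dA := dlog1.sub ((dP1.add dP2).div_const (2 * l - 1))
  have hfun : antideriv l = fun y => Real.log (l - 1 + y) -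
      ((l - y) * Real.log (l - y) + (l - 1 + y) * Real.log (l - 1 + y)) / (2 * l - 1) := by
    funext y; rfl
  rw [hfun]
  refine dA.congr_deriv ?_
  simp only [f]
  rw [Real.log_div h2.ne' h1.ne']
  field_simp
  ring

/-- `f` is continuous on `[0,1]` (for `λ > 1`). [cite: Polymath8b2014, Corollary 6.3 (proof)] -/
theorem continuousOn_f {l : ℝ} (hl : 1 < l) : ContinuousOn (f l) (Icc 0 1) := by
  have h1 : ∀ x ∈ Icc (0:ℝ) 1, l - 1 + x ≠ 0 := fun x hx => by linarith [hx.1]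
  have h2 : ∀ x ∈ Icc (0:ℝ) 1, l - x ≠ 0 := fun x hx => by linarith [hx.2]
  have hc1 : ContinuousOn (fun x : ℝ => l - 1 + x) (Icc 0 1) := (continuous_const.add continuous_id).continuousOn
  have hc2 : ContinuousOn (fun x : ℝ => l - x) (Icc 0 1) := (continuous_const.sub continuous_id).continuousOn
  have hq : ContinuousOn (fun x : ℝ => (l - x) / (l - 1 + x)) (Icc 0 1) := hc2.div hc1 h1
  have hq0 : ∀ x ∈ Icc (0:ℝ) 1, (l - x) / (l - 1 + x) ≠ 0 := fun x hx =>
    div_ne_zero (h2 x hx) (h1 x hx)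
  exact (continuousOn_const.div hc1 h1).add (continuousOn_const.mul (hq.log hq0))

/-- **The antiderivative identity** of the proof of Corollary 6.3: for `λ > 1` and `0 ≤ x ≤ 1`,
`∫_0^{1-x} f(y) dy = ((λ-1+x)/(2λ-1)) log((λ-x)/(λ-1+x)) + (λ log λ - λ log(λ-1))/(2λ-1)`.
[cite: Polymath8b2014, Corollary 6.3 (proof, second display)] -/
theorem integral_f {l x : ℝ} (hl : 1 < l) (hx0 : 0 ≤ x) (hx1 : x ≤ 1) :
    ∫ y in (0:ℝ)..(1 - x), f l y =
      (l - 1 + x) / (2 * l - 1) * Real.log ((l - x) / (l - 1 + x)) +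
        (l * Real.log l - l * Real.log (l - 1)) / (2 * l - 1) := by
  have hFTC : ∫ y in (0:ℝ)..(1 - x), f l y = antideriv l (1 - x) - antideriv l 0 := by
    apply intervalIntegral.integral_eq_sub_of_hasDerivAt
    · intro u hu
      rw [Set.uIcc_of_le (by linarith)] at hu
      exact hasDerivAt_antideriv (by linarith [hu.1]) (by linarith [hu.2])
    · apply ContinuousOn.intervalIntegrable
      rw [Set.uIcc_of_le (by linarith)]
      exact (continuousOn_f hl).mono (Icc_subset_Icc le_rfl (by linarith))
  rw [hFTC, antideriv, antideriv]
  have e1 : l - 1 + (1 - x) = l - x := by ring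
  have e2 : l - (1 - x) = l - 1 + x := by ring
  have e3 : l - 1 + (0:ℝ) = l - 1 := by ring
  have e4 : l - (0:ℝ) = l := by ring
  rw [e1, e2, e3, e4, Real.log_div (by linarith) (by linarith)]
  have h2l : (2 * l - 1) ≠ 0 := by linarith
  set A1 := Real.log (l - x)
  set A2 := Real.log (l - 1 + x)
  set A3 := Real.log l
  set A4 := Real.log (l - 1)
  have hD : (2 * l - 1) * (2 * l - 1)⁻¹ = 1 := mul_inv_cancel₀ h2l
  linear_combination (A4 - A1) * hD

/-- Under Polymath's equation `2λ - 1 = λ log λ - λ log(λ-1)` (display (ll1)), the antiderivative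
identity becomes `∫_0^{1-x} f(y) dy = (λ - 1 + x) f(x)` for `0 ≤ x ≤ 1`.
[cite: Polymath8b2014, Corollary 6.3 (proof, display after (ll1))] -/
theorem integral_f_eq_mul {l x : ℝ} (hl : 1 < l)
    (heq : 2 * l - 1 = l * Real.log l - l * Real.log (l - 1)) (hx0 : 0 ≤ x) (hx1 : x ≤ 1) :
    ∫ y in (0:ℝ)..(1 - x), f l y = (l - 1 + x) * f l x := by
  rw [integral_f hl hx0 hx1, ← heq, f]
  have h2l : (2 * l - 1) ≠ 0 := by linarith
  have h1 : l - 1 + x ≠ 0 := by linarith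
  set Lg := Real.log ((l - x) / (l - 1 + x))
  have hD : (2 * l - 1) * (2 * l - 1)⁻¹ = 1 := mul_inv_cancel₀ h2l
  have hE : (l - 1 + x) * (l - 1 + x)⁻¹ = 1 := mul_inv_cancel₀ h1
  linear_combination hD - hE

/-- Under (ll1), `f(1) = 0`. [cite: Polymath8b2014, Corollary 6.3 (proof)] -/
theorem f_one {l : ℝ} (hl : 1 < l) (heq : 2 * l - 1 = l * Real.log l - l * Real.log (l - 1)) :
    f l 1 = 0 := by
  rw [f]
  have e1 : l - 1 + (1:ℝ) = l := by ring
  rw [e1, Real.log_div (by linarith) (by linarith)]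
  have hl0 : l ≠ 0 := by linarith
  have h2l : (2 * l - 1) ≠ 0 := by linarith
  have hD : Real.log (l - 1) - Real.log l = -(2 * l - 1) / l := by
    rw [eq_div_iff hl0]
    linarith
  rw [hD]
  have hD' : (2 * l - 1) * (2 * l - 1)⁻¹ = 1 := mul_inv_cancel₀ h2l
  linear_combination (-(l⁻¹)) * hD'

/-- `f` is strictly decreasing on `[0,1]` (every summand is non-increasing, `1/(λ-1+x)` strictly).
[cite: Polymath8b2014, Corollary 6.3 (proof)] -/
theorem f_strictAntiOn {l : ℝ} (hl : 1 < l) : StrictAntiOn (f l) (Icc 0 1) := by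
  intro x hx y hy hxy
  simp only [f]
  have hx0 := hx.1; have hy1 := hy.2
  have h1 : 1 / (l - 1 + y) < 1 / (l - 1 + x) :=
    one_div_lt_one_div_of_lt (by linarith) (by linarith)
  have hlog : Real.log ((l - y) / (l - 1 + y)) ≤ Real.log ((l - x) / (l - 1 + x)) := by
    apply Real.log_le_log (div_pos (by linarith) (by linarith))
    rw [div_le_div_iff₀ (by linarith) (by linarith)]
    nlinarith
  have hc : 0 ≤ 1 / (2 * l - 1) := by
    have : 0 < 2 * l - 1 := by linarith
    positivity
  have := mul_le_mul_of_nonneg_left hlog hc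
  linarith

/-- Under (ll1), `f > 0` on `[0,1)`. [cite: Polymath8b2014, Corollary 6.3 (proof)] -/
theorem f_pos {l : ℝ} (hl : 1 < l) (heq : 2 * l - 1 = l * Real.log l - l * Real.log (l - 1))
    {x : ℝ} (hx0 : 0 ≤ x) (hx1 : x < 1) : 0 < f l x := by
  have h := f_strictAntiOn hl ⟨hx0, hx1.le⟩ ⟨zero_le_one, le_rfl⟩ hx1
  rwa [f_one hl heq] at h

/-- Under (ll1), `0 ≤ f ≤ f(0)` on `[0,1]`. [cite: Polymath8b2014, Corollary 6.3 (proof)] -/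
theorem f_nonneg_le {l : ℝ} (hl : 1 < l) (heq : 2 * l - 1 = l * Real.log l - l * Real.log (l - 1))
    {x : ℝ} (hx0 : 0 ≤ x) (hx1 : x ≤ 1) : 0 ≤ f l x ∧ f l x ≤ f l 0 := by
  have hanti := (f_strictAntiOn hl).antitoneOn
  constructor
  · have h := hanti ⟨hx0, hx1⟩ ⟨zero_le_one, le_rfl⟩ hx1
    rwa [f_one hl heq] at h
  · exact hanti ⟨le_rfl, zero_le_one⟩ ⟨hx0, hx1⟩ hx0

/-! ### The two-variable test function and the eigen-equation -/

/-- Polymath's eigenfunction `F(x,y) = f(x) + f(y)` on `R_2`, extended by `0`.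
[cite: Polymath8b2014, Corollary 6.3 (proof, definition of F)] -/
noncomputable def testFn (l : ℝ) : (Fin 2 → ℝ) → ℝ :=
  (maynardSimplex 2).indicator fun t => f l (t 0) + f l (t 1)

/-- Membership in `R_2`: `t₀, t₁ ≥ 0` and `t₀ + t₁ ≤ 1`. [cite: Polymath8b2014, §6 (R_k)] -/
theorem mem_maynardSimplex_two {t : Fin 2 → ℝ} :
    t ∈ maynardSimplex 2 ↔ 0 ≤ t 0 ∧ 0 ≤ t 1 ∧ t 0 + t 1 ≤ 1 := by
  simp only [maynardSimplex, Set.mem_setOf_eq, Fin.forall_fin_two, Fin.sum_univ_two, and_assoc]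

/-- `f` is measurable. [cite: Polymath8b2014, Corollary 6.3 (proof)] -/
theorem measurable_f (l : ℝ) : Measurable (f l) := by
  unfold f
  exact (measurable_const.div (measurable_const.add measurable_id)).add
    (measurable_const.mul (Real.measurable_log.comp
      ((measurable_const.sub measurable_id).div (measurable_const.add measurable_id))))

/-- The test function is measurable. [cite: Polymath8b2014, Corollary 6.3 (proof)] -/
theorem measurable_testFn (l : ℝ) : Measurable (testFn l) :=
  (((measurable_f l).comp (measurable_pi_apply 0)).add
    ((measurable_f l).comp (measurable_pi_apply 1))).indicator (measurableSet_maynardSimplex 2)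

/-- The test function on the simplex. [cite: Polymath8b2014, Corollary 6.3 (proof)] -/
theorem testFn_of_mem (l : ℝ) {t : Fin 2 → ℝ} (ht : t ∈ maynardSimplex 2) :
    testFn l t = f l (t 0) + f l (t 1) := by
  rw [testFn, Set.indicator_of_mem ht]

/-- The test function vanishes off the simplex. [cite: Polymath8b2014, Corollary 6.3 (proof)] -/
theorem testFn_of_not_mem (l : ℝ) {t : Fin 2 → ℝ} (ht : t ∉ maynardSimplex 2) :
    testFn l t = 0 := by
  rw [testFn, Set.indicator_of_notMem ht]

/-- Under (ll1) the test function is strictly positive on `R_2` and bounded by `2 f(0)` there.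
[cite: Polymath8b2014, Corollary 6.3 (proof: "F : R_2 → (0,+∞)")] -/
theorem testFn_pos_le {l : ℝ} (hl : 1 < l) (heq : 2 * l - 1 = l * Real.log l - l * Real.log (l - 1))
    {t : Fin 2 → ℝ} (ht : t ∈ maynardSimplex 2) :
    0 < testFn l t ∧ |testFn l t| ≤ 2 * f l 0 := by
  rw [testFn_of_mem l ht]
  obtain ⟨h0, h1, hs⟩ := mem_maynardSimplex_two.1 ht
  have b0 := f_nonneg_le hl heq h0 (by linarith)
  have b1 := f_nonneg_le hl heq h1 (by linarith)
  refine ⟨?_, ?_⟩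
  · rcases lt_or_ge (t 0) 1 with h | h
    · exact add_pos_of_pos_of_nonneg (f_pos hl heq h0 h) b1.1
    · have ht1 : t 1 = 0 := by linarith
      rw [ht1]
      exact add_pos_of_nonneg_of_pos b0.1 (f_pos hl heq le_rfl zero_lt_one)
  · rw [abs_of_nonneg (add_nonneg b0.1 b1.1)]
    linarith [b0.2, b1.2]

/-- The `m`-th fibre integral of the test function on `R_2` equals `λ · f(other coordinate)`:
`∫_0^{1-t₁} (f(u) + f(t₁)) du = (λ-1+t₁) f(t₁) + (1-t₁) f(t₁) = λ f(t₁)`, and symmetrically.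
[cite: Polymath8b2014, Corollary 6.3 (proof, last display)] -/
theorem fibreIntegral_testFn {l : ℝ} (hl : 1 < l)
    (heq : 2 * l - 1 = l * Real.log l - l * Real.log (l - 1)) {t : Fin 2 → ℝ}
    (ht : t ∈ maynardSimplex 2) :
    MaynardCW.fibreIntegral 0 (testFn l) t = l * f l (t 1) ∧
      MaynardCW.fibreIntegral 1 (testFn l) t = l * f l (t 0) := by
  obtain ⟨h0, h1, hs⟩ := mem_maynardSimplex_two.1 ht
  have hsum : ∑ j, t j = t 0 + t 1 := Fin.sum_univ_two t
  have lim0 : 1 - ∑ j ∈ univ.erase (0 : Fin 2), t j = 1 - t 1 := by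
    rw [MaynardCW.sub_sum_erase_eq, hsum]; ring
  have lim1 : 1 - ∑ j ∈ univ.erase (1 : Fin 2), t j = 1 - t 0 := by
    rw [MaynardCW.sub_sum_erase_eq, hsum]; ring
  -- interval integrability of `f` on subintervals of `[0,1]`
  have hii : ∀ b : ℝ, 0 ≤ b → b ≤ 1 → IntervalIntegrable (f l) volume 0 b := fun b hb0 hb1 => by
    apply ContinuousOn.intervalIntegrable
    rw [Set.uIcc_of_le hb0]
    exact (continuousOn_f hl).mono (Icc_subset_Icc le_rfl hb1)
  constructor
  · rw [MaynardCW.fibreIntegral_eq_intervalIntegral 0 (testFn l) (by rw [lim0]; linarith), lim0]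
    have hcongr : ∫ u in (0:ℝ)..(1 - t 1), testFn l (Function.update t 0 u) =
        ∫ u in (0:ℝ)..(1 - t 1), (f l u + f l (t 1)) := by
      apply intervalIntegral.integral_congr
      intro u hu
      rw [Set.uIcc_of_le (by linarith)] at hu
      have hmem : Function.update t 0 u ∈ maynardSimplex 2 := by
        rw [mem_maynardSimplex_two]
        simp only [Function.update_self, ne_eq, one_ne_zero, not_false_eq_true,
          Function.update_of_ne]
        exact ⟨hu.1, h1, by linarith [hu.2]⟩
      simp only [testFn_of_mem l hmem, Function.update_self, ne_eq, one_ne_zero, not_false_eq_true,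
        Function.update_of_ne]
    rw [hcongr, intervalIntegral.integral_add (hii _ (by linarith) (by linarith))
      intervalIntegrable_const, intervalIntegral.integral_const,
      integral_f_eq_mul hl heq h1 (by linarith), smul_eq_mul]
    ring
  · rw [MaynardCW.fibreIntegral_eq_intervalIntegral 1 (testFn l) (by rw [lim1]; linarith), lim1]
    have hcongr : ∫ u in (0:ℝ)..(1 - t 0), testFn l (Function.update t 1 u) =
        ∫ u in (0:ℝ)..(1 - t 0), (f l u + f l (t 0)) := by
      apply intervalIntegral.integral_congr
      intro u hu
      rw [Set.uIcc_of_le (by linarith)] at hu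
      have hmem : Function.update t 1 u ∈ maynardSimplex 2 := by
        rw [mem_maynardSimplex_two]
        simp only [Function.update_self, ne_eq, zero_ne_one, not_false_eq_true,
          Function.update_of_ne]
        exact ⟨h0, hu.1, by linarith [hu.2]⟩
      simp only [testFn_of_mem l hmem, Function.update_self, ne_eq, zero_ne_one, not_false_eq_true,
        Function.update_of_ne]
      ring
    rw [hcongr, intervalIntegral.integral_add (hii _ (by linarith) (by linarith))
      intervalIntegrable_const, intervalIntegral.integral_const,
      integral_f_eq_mul hl heq h0 (by linarith), smul_eq_mul]
    ring

/-- **The eigen-equation** of the proof of Corollary 6.3: on `R_2`,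
`(ℒF)(t) = ∫_0^{1-t₁} F(x',t₁) dx' + ∫_0^{1-t₀} F(t₀,y') dy' = λ F(t)`.
[cite: Polymath8b2014, Corollary 6.3 (proof, last display)] -/
theorem maynardOperator_testFn {l : ℝ} (hl : 1 < l)
    (heq : 2 * l - 1 = l * Real.log l - l * Real.log (l - 1)) {t : Fin 2 → ℝ}
    (ht : t ∈ maynardSimplex 2) :
    MaynardCW.maynardOperator (testFn l) t = l * testFn l t := by
  obtain ⟨e0, e1⟩ := fibreIntegral_testFn hl heq ht
  rw [MaynardCW.maynardOperator_def, Fin.sum_univ_two, e0, e1, testFn_of_mem l ht]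
  ring

/-- `I_2(F) > 0`: on the square `[0,1/2]² ⊆ R_2` the test function is `≥ 2 f(1/2) > 0`.
[cite: Polymath8b2014, Corollary 6.3 (proof)] -/
theorem maynardI_testFn_pos {l : ℝ} (hl : 1 < l)
    (heq : 2 * l - 1 = l * Real.log l - l * Real.log (l - 1)) :
    0 < maynardI 2 (testFn l) := by
  rw [maynardI]
  set Q : Set (Fin 2 → ℝ) := Icc (fun _ => (0:ℝ)) (fun _ => 1 / 2) with hQ
  have hQR : Q ⊆ maynardSimplex 2 := by
    intro t ht
    rw [hQ, Set.mem_Icc] at ht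
    have a0 := ht.1 0; have a1 := ht.1 1; have b0 := ht.2 0; have b1 := ht.2 1
    simp only at a0 a1 b0 b1
    exact mem_maynardSimplex_two.2 ⟨a0, a1, by linarith⟩
  set c : ℝ := (2 * f l (1 / 2)) ^ 2 with hc
  have hfhalf : 0 < f l (1 / 2) := f_pos hl heq (by norm_num) (by norm_num)
  have hc0 : 0 < c := by positivity
  -- integrability of `F²` on `R_2` (bounded by `(2 f 0)²`)
  have hm : Measurable fun t => testFn l t ^ 2 := (measurable_testFn l).pow_const 2
  have hint : IntegrableOn (fun t => testFn l t ^ 2) (maynardSimplex 2) := by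
    refine Measure.integrableOn_of_bounded (M := (2 * f l 0) ^ 2)
      (isCompact_maynardSimplex 2).measure_lt_top.ne hm.aestronglyMeasurable ?_
    rw [ae_restrict_iff' (measurableSet_maynardSimplex 2)]
    refine Eventually.of_forall fun t ht => ?_
    rw [Real.norm_eq_abs, abs_pow]
    exact pow_le_pow_left₀ (abs_nonneg _) (testFn_pos_le hl heq ht).2 2
  -- lower bound on the square
  have hvol : (volume Q).toReal = 1 / 4 := by
    rw [hQ, Real.volume_Icc_pi_toReal (fun _ => by norm_num)]
    simp only [Fin.prod_univ_two]
    norm_num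
  have hQfin : volume Q ≠ ∞ := by
    rw [hQ, Real.volume_Icc_pi]; simp
  have hlow : ∫ t in Q, c ≤ ∫ t in Q, testFn l t ^ 2 := by
    refine setIntegral_mono_on (integrableOn_const hQfin) (hint.mono_set hQR)
      measurableSet_Icc fun t ht => ?_
    have htR := hQR ht
    rw [hQ, Set.mem_Icc] at ht
    have b0 := ht.2 0; have b1 := ht.2 1
    have a0 := ht.1 0; have a1 := ht.1 1
    simp only at a0 a1 b0 b1
    have hanti := (f_strictAntiOn hl).antitoneOn
    have g0 : f l (1 / 2) ≤ f l (t 0) := hanti ⟨a0, by linarith⟩ ⟨by norm_num, by norm_num⟩ b0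
    have g1 : f l (1 / 2) ≤ f l (t 1) := hanti ⟨a1, by linarith⟩ ⟨by norm_num, by norm_num⟩ b1
    rw [testFn_of_mem l htR, hc]
    have hsum : 2 * f l (1 / 2) ≤ f l (t 0) + f l (t 1) := by linarith
    exact pow_le_pow_left₀ (by positivity) hsum 2
  have hconst : ∫ t in Q, c = c * (1 / 4) := by
    rw [setIntegral_const, measureReal_def, hvol, smul_eq_mul, mul_comm]
  have hmono : ∫ t in Q, testFn l t ^ 2 ≤ ∫ t in maynardSimplex 2, testFn l t ^ 2 :=
    setIntegral_mono_set hint (Eventually.of_forall fun t => sq_nonneg _)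
      (Eventually.of_forall hQR)
  linarith

/-! ### The constant `λ = M₂`: a root of (ll1) in `(1.38593, 1.38594)` -/

/-- Polymath's equation (ll1) as a function: `g(λ) = λ log λ - λ log(λ-1) - (2λ - 1)`.
[cite: Polymath8b2014, Corollary 6.3 (proof, display (ll1))] -/
noncomputable def eqnFn (l : ℝ) : ℝ := l * Real.log l - l * Real.log (l - 1) - (2 * l - 1)

/-- `g` on `(1,∞)` in the form `λ log(λ/(λ-1)) - (2λ-1)`. [cite: Polymath8b2014, Corollary 6.3 (proof)] -/
theorem eqnFn_eq {l : ℝ} (hl : 1 < l) :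
    eqnFn l = l * Real.log (l / (l - 1)) - (2 * l - 1) := by
  rw [eqnFn, Real.log_div (by linarith) (by linarith)]; ring

/-- `g` is continuous on `[a,b] ⊂ (1,∞)`. [cite: Polymath8b2014, Corollary 6.3 (proof)] -/
theorem continuousOn_eqnFn {a b : ℝ} (ha : 1 < a) : ContinuousOn eqnFn (Icc a b) := by
  have h0 : ∀ x ∈ Icc a b, x ≠ 0 := fun x hx => by linarith [hx.1]
  have h1 : ∀ x ∈ Icc a b, x - 1 ≠ 0 := fun x hx => by linarith [hx.1]
  unfold eqnFn
  refine ((continuousOn_id.mul (continuousOn_id.log h0)).sub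
    (continuousOn_id.mul ((continuousOn_id.sub continuousOn_const).log h1))).sub ?_
  exact (continuousOn_const.mul continuousOn_id).sub continuousOn_const

/-- `g(1.38593) > 0`, kernel-certified via the `KernelLogRatio` enclosure of
`log(138593/38593) = log((88593+50000)/(88593-50000))`. [cite: Polymath8b2014, Corollary 6.3 (M_2 = 1.38593…)] -/
theorem eqnFn_pos_left : 0 < eqnFn (138593 / 100000) := by
  have hl : (1:ℝ) < 138593 / 100000 := by norm_num
  rw [eqnFn_eq hl]
  have h := (Literature.Analysis.SpecialFunctions.KernelLogRatio.log_ratio_mem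
    (p := 50000) (q := 88593) (by norm_num) 64 5 8).1
  have e : (((88593:ℕ):ℝ) + ((50000:ℕ):ℝ)) / (((88593:ℕ):ℝ) - ((50000:ℕ):ℝ)) =
      (138593 / 100000 : ℝ) / (138593 / 100000 - 1) := by norm_num
  rw [e] at h
  have hN : 177186 * 2 ^ 64 <
      138593 * Literature.Analysis.SpecialFunctions.KernelLogRatio.logRatioLo 50000 88593 64 5 8 := by
    decide +kernel
  have hN' : (177186:ℝ) * 2 ^ 64 <
      138593 * (Literature.Analysis.SpecialFunctions.KernelLogRatio.logRatioLo 50000 88593 64 5 8 : ℝ) := by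
    exact_mod_cast hN
  set Lo := (Literature.Analysis.SpecialFunctions.KernelLogRatio.logRatioLo 50000 88593 64 5 8 : ℝ)
  set L := Real.log ((138593 / 100000 : ℝ) / (138593 / 100000 - 1))
  have h2 : Lo ≤ 2 ^ 64 * L := by
    have := h; rw [div_le_iff₀ (by positivity)] at this; linarith
  nlinarith [h2, hN']

/-- `g(1.38594) < 0`, kernel-certified via the `KernelLogRatio` enclosure of
`log(138594/38594) = log((44297+25000)/(44297-25000))`. [cite: Polymath8b2014, Corollary 6.3 (M_2 = 1.38593…)] -/
theorem eqnFn_neg_right : eqnFn (138594 / 100000) < 0 := by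
  have hl : (1:ℝ) < 138594 / 100000 := by norm_num
  rw [eqnFn_eq hl]
  have h := (Literature.Analysis.SpecialFunctions.KernelLogRatio.log_ratio_mem
    (p := 25000) (q := 44297) (by norm_num) 64 5 8).2
  have e : (((44297:ℕ):ℝ) + ((25000:ℕ):ℝ)) / (((44297:ℕ):ℝ) - ((25000:ℕ):ℝ)) =
      (138594 / 100000 : ℝ) / (138594 / 100000 - 1) := by norm_num
  rw [e] at h
  have hN : 69297 * Literature.Analysis.SpecialFunctions.KernelLogRatio.logRatioHi 25000 44297 64 5 8 <
      88594 * 2 ^ 64 := by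
    decide +kernel
  have hN' : (69297:ℝ) *
      (Literature.Analysis.SpecialFunctions.KernelLogRatio.logRatioHi 25000 44297 64 5 8 : ℝ) <
      88594 * 2 ^ 64 := by
    exact_mod_cast hN
  set Hi := (Literature.Analysis.SpecialFunctions.KernelLogRatio.logRatioHi 25000 44297 64 5 8 : ℝ)
  set L := Real.log ((138594 / 100000 : ℝ) / (138594 / 100000 - 1))
  have h2 : 2 ^ 64 * L ≤ Hi := by
    have := h; rw [le_div_iff₀ (by positivity)] at this; linarith
  nlinarith [h2, hN']

/-- **(ll1) has a root in `(1.38593, 1.38594)`** (intermediate value theorem between the two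
kernel-certified signs). [cite: Polymath8b2014, Corollary 6.3 (M_2 = 1/(1-W(1/e)) = 1.38593…)] -/
theorem exists_root : ∃ l ∈ Ioo (138593 / 100000 : ℝ) (138594 / 100000),
    2 * l - 1 = l * Real.log l - l * Real.log (l - 1) := by
  have hab : (138593 / 100000 : ℝ) ≤ 138594 / 100000 := by norm_num
  have hcont := continuousOn_eqnFn (a := 138593 / 100000) (b := 138594 / 100000) (by norm_num)
  have hmem : (0:ℝ) ∈ Ioo (eqnFn (138594 / 100000)) (eqnFn (138593 / 100000)) :=
    ⟨eqnFn_neg_right, eqnFn_pos_left⟩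
  obtain ⟨l, hl, hgl⟩ := intermediate_value_Ioo' hab hcont hmem
  refine ⟨l, hl, ?_⟩
  rw [eqnFn] at hgl
  linarith

/-- **`M₂`**: the root `λ` of (ll1) produced by `exists_root` (`= 1/(1 - W(1/e)) = 1.38593…`).
[cite: Polymath8b2014, Corollary 6.3] -/
noncomputable def mTwo : ℝ := Classical.choose exists_root

/-- `1.38593 < M₂ < 1.38594`. [cite: Polymath8b2014, Corollary 6.3 (1.38593…)] -/
theorem mTwo_mem_Ioo : mTwo ∈ Ioo (138593 / 100000 : ℝ) (138594 / 100000) :=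
  (Classical.choose_spec exists_root).1

/-- `M₂` satisfies (ll1): `2λ - 1 = λ log λ - λ log(λ - 1)`. [cite: Polymath8b2014, Corollary 6.3 (ll1)] -/
theorem mTwo_eqn : 2 * mTwo - 1 = mTwo * Real.log mTwo - mTwo * Real.log (mTwo - 1) :=
  (Classical.choose_spec exists_root).2

/-- `1 < M₂`. [cite: Polymath8b2014, Corollary 6.3] -/
theorem one_lt_mTwo : 1 < mTwo := by
  have h := mTwo_mem_Ioo.1; linarith

/-- **The Lambert-`W` form**: `w := 1 - 1/λ` satisfies `w e^w = e^{-1}`, i.e. `w = W(1/e)` and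
`λ = 1/(1 - W(1/e))` as printed. [cite: Polymath8b2014, Corollary 6.3 (statement)] -/
theorem mTwo_lambertW : (1 - 1 / mTwo) * Real.exp (1 - 1 / mTwo) = Real.exp (-1) := by
  have hl := one_lt_mTwo
  have hl0 : mTwo ≠ 0 := by linarith
  have heq := mTwo_eqn
  -- (ll1) ⇔ log((λ-1)/λ) = 1/λ - 2
  have hlog : Real.log ((mTwo - 1) / mTwo) = 1 / mTwo - 2 := by
    rw [Real.log_div (by linarith) hl0]
    field_simp
    linarith
  have hw : 1 - 1 / mTwo = (mTwo - 1) / mTwo := by field_simp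
  have hpos : (0:ℝ) < 1 - 1 / mTwo := by rw [hw]; exact div_pos (by linarith) (by linarith)
  have hlog' : Real.log (1 - 1 / mTwo) = 1 / mTwo - 2 := by rw [hw, hlog]
  have hval : Real.exp (1 / mTwo - 2) = 1 - 1 / mTwo := by rw [← hlog', Real.exp_log hpos]
  calc (1 - 1 / mTwo) * Real.exp (1 - 1 / mTwo)
      = Real.exp (1 / mTwo - 2) * Real.exp (1 - 1 / mTwo) := by rw [hval]
    _ = Real.exp (-1) := by rw [← Real.exp_add]; congr 1; ring

end PolymathMTwo

open MaynardCW PolymathMTwo in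
/-- **Polymath 8b, Corollary 6.3 (Computation of `M₂`).**  With `λ = PolymathMTwo.mTwo`
(`= 1/(1 - W(1/e)) ∈ (1.38593, 1.38594)`, the root of `2λ - 1 = λ log λ - λ log(λ-1)`): every
admissible `F` on `R_2` has `(J_2^{(1)}(F) + J_2^{(2)}(F))/I_2(F) ≤ λ`, and Polymath's eigenfunction
`F(x,y) = f(x) + f(y)` is admissible and attains `λ`.  Hence `M_2 = λ`.
[cite: Polymath8b2014, Corollary 6.3 (p. 24)] -/
theorem maynardFunctional_two_eq :
    (∀ F, IsMaynardAdmissible 2 F → maynardFunctional 2 F ≤ PolymathMTwo.mTwo) ∧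
      IsMaynardAdmissible 2 (PolymathMTwo.testFn PolymathMTwo.mTwo) ∧
      maynardFunctional 2 (PolymathMTwo.testFn PolymathMTwo.mTwo) = PolymathMTwo.mTwo := by
  have hl := one_lt_mTwo
  have heq := mTwo_eqn
  have hGm := measurable_testFn mTwo
  have hG : ∀ t, t ∉ maynardSimplex 2 → testFn mTwo t = 0 := fun t ht => testFn_of_not_mem mTwo ht
  have hB : ∀ t ∈ maynardSimplex 2, |testFn mTwo t| ≤ 2 * f mTwo 0 :=
    fun t ht => (testFn_pos_le hl heq ht).2
  have hpos : ∀ t ∈ maynardSimplex 2, 0 < testFn mTwo t := fun t ht => (testFn_pos_le hl heq ht).1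
  have hI := maynardI_testFn_pos hl heq
  have heig : ∀ t ∈ maynardSimplex 2, maynardOperator (testFn mTwo) t = mTwo * testFn mTwo t :=
    fun t ht => maynardOperator_testFn hl heq ht
  obtain ⟨hup, hval⟩ := maynardFunctional_eq_of_eigenfunction (n := 1) hGm hG hB hpos hI heig
  refine ⟨hup, ?_, hval⟩
  exact
    { measurable := hGm
      support_subset := fun t ht => by by_contra h; exact ht (hG t h)
      integrableOn_sq := by
        refine IntegrableOn.of_bound (isCompact_maynardSimplex 2).measure_lt_top
          (hGm.pow_const 2).aestronglyMeasurable ((2 * f mTwo 0) ^ 2) ?_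
        rw [ae_restrict_iff' (measurableSet_maynardSimplex 2)]
        refine ae_of_all _ fun t ht => ?_
        rw [Real.norm_eq_abs, abs_pow]
        exact pow_le_pow_left₀ (abs_nonneg _) (hB t ht) 2
      maynardI_pos := hI }

open PolymathMTwo in
/-- `M_2 = λ` as an `IsGreatest` statement on the set of values of Maynard's functional over
admissible test functions on `R_2`. [cite: Polymath8b2014, Corollary 6.3 (p. 24)] -/
theorem isGreatest_maynardFunctional_two :
    IsGreatest {M : ℝ | ∃ F, IsMaynardAdmissible 2 F ∧ maynardFunctional 2 F = M}
      PolymathMTwo.mTwo := by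
  obtain ⟨hup, hadm, hval⟩ := maynardFunctional_two_eq
  refine ⟨⟨testFn mTwo, hadm, hval⟩, ?_⟩
  rintro M ⟨F, hF, rfl⟩
  exact hup F hF

end Literature.NumberTheory.Sieve
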